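import Summits.SmoothPoincare4.SmoothPoincare4.Theses.InformationMetricHadamard
import Summits.SmoothPoincare4.SmoothPoincare4.Theses.EinsteinBulk
import Summits.SmoothPoincare4.SmoothPoincare4.Theorems.InformationMetricHadamardAhHadamardFillingUcstReduction
import Summits.SmoothPoincare4.SmoothPoincare4.Theorems.InformationMetricHadamardAhHadamardFillingStubCompactificationCollar
import Literature.Geometry.Lorentzian.LeviCivitaCurvature

/-!
# Crux `InformationMetricHadamard.AhHadamardFilling` (item stmt-SmoothPoincare4-6014) —
# line `einstein-bulk-transfer`: the reduction to the Einstein-bulk items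

The crux BY NAME from the three sibling items of route `EinsteinBulk` —
`YamabeExtremalSpheres` (stmt-SmoothPoincare4-7998), `PEFillNearRound` (-7997) and the Li–Qing–Shi
pinching statement `YamabePinchedEinsteinBulk` (-7996) — which enter as tagged route hypotheses,
and the LANDED owned statement of the line, the compactification collar
`stub_compactificationCollar` (`…StubCompactificationCollar.lean`): for a homotopy 4-sphere `Σ`,
Li–Qing–Shi at `ε = 1/2` and the PE-filling threshold give `η`; Yamabe-extremality gives the
near-round class `[g₀]`; the PE filling `(N, g)` of `(Σ, [g₀])` is pinched, so `Rm ≤ 0` on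
orthonormal pairs, hence `sec ≤ 0` for every Levi-Civita connection (the curvature-format bridge
`sectionalCurvature_nonpos_of_orthonormal_leviCivita`); the compactification collar is the crux's
end collar over `(Σ, κ₀ g₀)`; `ahHadamardFilling_of_connectedCollarFillings` (p124840) supplies
completeness, the closure clause and simple connectivity. Sorry-free; conditional exactly on the
three Einstein-bulk route items.
-/

noncomputable section

-- the prescribed namespace `Summit.<P>.<Sub>.…` duplicates `SmoothPoincare4` (P = Sub)
set_option linter.dupNamespace false

open scoped Manifold ContDiff Topology ContinuousMap
open Set Function Bundle
open Literature.Topology.FourManifolds Literature.Geometry.Lorentzian Literature.Geometry.Riemannian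
open Summit.SmoothPoincare4.SmoothPoincare4.Theses

namespace Summit.SmoothPoincare4.SmoothPoincare4.Cruxes.AhHadamardFilling.EinsteinBulkTransfer

/-! ## The curvature-format bridge: Einstein-bulk form ⇒ crux form -/

/-- Cauchy–Schwarz for a Riemannian pseudo-Riemannian metric: `g(X,Y)² ≤ g(X,X)·g(Y,Y)`, i.e. the
denominator of `sectionalCurvature` is nonnegative. [folklore] -/
theorem val_sq_le_val_mul_val (B : Type) [TopologicalSpace B] [T2Space B] [SecondCountableTopology B]
    [ChartedSpace (EuclideanSpace ℝ (Fin 5)) B] [IsManifold (𝓡 5) ∞ B]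
    (G : PseudoRiemannianMetric (𝓡 5) ∞ (EuclideanSpace ℝ (Fin 5)) (TangentSpace (𝓡 5) : B → Type _))
    (hG : G.IsRiemannian) (x : B) (X Y : TangentSpace (𝓡 5) x) :
    G.val x X Y ^ 2 ≤ G.val x X X * G.val x Y Y := by
  have hnn : ∀ w : TangentSpace (𝓡 5) x, 0 ≤ G.val x w w := by
    intro w
    by_cases hw : w = 0
    · subst hw; simp
    · exact (hG x w hw).le
  by_cases hY : Y = 0
  · subst hY; simp
  have hYY : 0 < G.val x Y Y := hG x Y hY
  set a : ℝ := G.val x X X with ha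
  set b : ℝ := G.val x X Y with hb
  set d : ℝ := G.val x Y Y with hd
  -- expand `0 ≤ g(dX - bY, dX - bY) = d (a d - b²)`
  have hexp : G.val x (d • X - b • Y) (d • X - b • Y) = d * (a * d - b ^ 2) := by
    have hYX : G.val x Y X = b := by rw [hb, G.symm x X Y]
    simp only [map_sub, map_smul, FunLike.coe_sub, Pi.sub_apply, FunLike.coe_smul, Pi.smul_apply,
      smul_eq_mul, hYX, ← ha, ← hb, ← hd]
    ring
  have h0 : 0 ≤ d * (a * d - b ^ 2) := hexp ▸ hnn _
  have h1 : 0 ≤ a * d - b ^ 2 := by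
    by_contra h
    rw [not_le] at h
    have : d * (a * d - b ^ 2) < 0 := mul_neg_of_pos_of_neg hYY h
    linarith
  linarith

/-- **Curvature-format bridge.** For the pseudo-Riemannian metric `G = ofRiemannian g` of a smooth
Riemannian 5-manifold: if `Rm(X,Y,Y,X) ≤ 0` on `G`-orthonormal pairs for the tree's Levi-Civita
connection `G.leviCivita`, then `sectionalCurvature cov x X Y ≤ 0` for EVERY Levi-Civita connection
`cov` of `G` and all pairs `X, Y` (the crux's curvature clause). Uniqueness of the Levi-Civita
curvature (`IsLeviCivita.curvature_eq_riemann`), Gram–Schmidt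
(`SimpleAH.curvatureForm_leviCivita_nonpos_of_orthonormal`) and Cauchy–Schwarz for the denominator.
[cite: ONeill1983, Ch. 3, Thm. 3.11 and Def. 3.39] -/
theorem sectionalCurvature_nonpos_of_orthonormal_leviCivita
    (N : Type) [TopologicalSpace N] [T2Space N] [SecondCountableTopology N]
    [ChartedSpace (EuclideanSpace ℝ (Fin 5)) N] [IsManifold (𝓡 5) ∞ N]
    (g : Bundle.ContMDiffRiemannianMetric (𝓡 5) ∞ (EuclideanSpace ℝ (Fin 5))
      (TangentSpace (𝓡 5) : N → Type _))
    [(PseudoRiemannianMetric.ofRiemannian g).HasLeviCivita]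
    (hK : ∀ (x : N) (X Y : TangentSpace (𝓡 5) x), g.inner x X X = 1 → g.inner x Y Y = 1 →
      g.inner x X Y = 0 →
      (PseudoRiemannianMetric.ofRiemannian g).curvatureForm
        (PseudoRiemannianMetric.ofRiemannian g).leviCivita x X Y Y X ≤ 0) :
    ∀ cov, (PseudoRiemannianMetric.ofRiemannian g).IsLeviCivita cov →
      ∀ (x : N) (X Y : TangentSpace (𝓡 5) x),
        (PseudoRiemannianMetric.ofRiemannian g).sectionalCurvature cov x X Y ≤ 0 := by
  intro cov hcov x X Y
  have hG : (PseudoRiemannianMetric.ofRiemannian g).IsRiemannian :=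
    PseudoRiemannianMetric.isRiemannian_ofRiemannian g
  have h2 : (2 : ℕ∞ω) ≤ (∞ : ℕ∞ω) := WithTop.coe_le_coe.2 le_top
  -- the numerator for the tree's Levi-Civita connection, on all pairs
  have hLC : (PseudoRiemannianMetric.ofRiemannian g).curvatureForm
      (PseudoRiemannianMetric.ofRiemannian g).leviCivita x X Y Y X ≤ 0 :=
    SimpleAH.curvatureForm_leviCivita_nonpos_of_orthonormal h2 hG hK x X Y
  -- the numerator for `cov` equals the one for `leviCivita`
  have hnum : (PseudoRiemannianMetric.ofRiemannian g).curvatureForm cov x X Y Y X ≤ 0 := by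
    unfold PseudoRiemannianMetric.curvatureForm at hLC ⊢
    rw [hcov.curvature_eq_riemann h2 x]
    exact hLC
  -- the denominator is nonnegative
  have hden : 0 ≤ (PseudoRiemannianMetric.ofRiemannian g).val x X X *
      (PseudoRiemannianMetric.ofRiemannian g).val x Y Y -
      (PseudoRiemannianMetric.ofRiemannian g).val x X Y ^ 2 :=
    sub_nonneg.2 (val_sq_le_val_mul_val N _ hG x X Y)
  unfold PseudoRiemannianMetric.sectionalCurvature
  exact div_nonpos_of_nonpos_of_nonneg hnum hden

/-! ## A constant rescaling of a pseudo-Riemannian metric (for `κ₀ g₀`) -/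

/-- A positive constant multiple `κ • g` of a smooth Riemannian pseudo-metric is again a smooth
Riemannian pseudo-metric, with `(κ • g)(v, w) = κ g(v, w)`. [folklore] -/
theorem exists_scaledMetric {B : Type} [TopologicalSpace B]
    [ChartedSpace (EuclideanSpace ℝ (Fin 4)) B] [IsManifold (𝓡 4) ∞ B] {κ : ℝ} (hκ : 0 < κ)
    (g : PseudoRiemannianMetric (𝓡 4) ∞ (EuclideanSpace ℝ (Fin 4)) (TangentSpace (𝓡 4) : B → Type _))
    (hg : g.IsRiemannian) :
    ∃ g' : PseudoRiemannianMetric (𝓡 4) ∞ (EuclideanSpace ℝ (Fin 4)) (TangentSpace (𝓡 4) : B → Type _),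
      g'.IsRiemannian ∧ ∀ (b : B) (v w : TangentSpace (𝓡 4) b), g'.val b v w = κ * g.val b v w := by
  have hval : ∀ (b : B) (v w : TangentSpace (𝓡 4) b), (κ • g.val b) v w = κ * g.val b v w :=
    fun b v w => by simp only [FunLike.coe_smul, Pi.smul_apply, smul_eq_mul]
  refine ⟨{ val := fun b => κ • g.val b, symm := ?_, nondegenerate := ?_, contMDiff := ?_ }, ?_, ?_⟩
  · intro b v w
    show (κ • g.val b) v w = (κ • g.val b) w v
    rw [hval, hval, g.symm b v w]
  · intro b v hv
    refine g.nondegenerate b v fun w => ?_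
    have h : (κ • g.val b) v w = 0 := hv w
    rw [hval, mul_eq_zero] at h
    exact h.resolve_left hκ.ne'
  · set_option synthInstance.maxHeartbeats 200000 in
    exact g.contMDiff.const_smul_section (a := κ)
  · intro b v hv
    show 0 < (κ • g.val b) v v
    rw [hval]
    exact mul_pos hκ (hg b v hv)
  · intro b v w
    exact hval b v w

/-! ## The composition: Einstein-bulk items + the landed collar ⇒ the crux BY NAME -/

/-- **The connected `sec ≤ 0` collar filling of every homotopy 4-sphere, from the three
Einstein-bulk items and the compactification collar** (the input of
`ahHadamardFilling_of_connectedCollarFillings`, p124840). For a homotopy 4-sphere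
`Σ`: Li–Qing–Shi at `ε = 1/2` gives `δ₂`, PE-FILL gives `δ₃`; Yamabe-extremality at
`η = min δ₂ δ₃` gives `g₀`; PE-FILL fills `(Σ,[g₀])` by a `C²`-conformally compact Einstein
`(N, g)`; Li–Qing–Shi pinches it, so `Rm ≤ 0` on orthonormal pairs, hence (bridge) `sec ≤ 0` for
every Levi-Civita connection; the compactification collar gives the crux's collar over
`(Σ, g₀)`; p124840 supplies completeness, the closure clause and simple connectivity. -/
theorem connectedCollarFillings_of
    (hY : EinsteinBulk.YamabeExtremalSpheres)
    (hP : EinsteinBulk.PEFillNearRound)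
    (hL : EinsteinBulk.YamabePinchedEinsteinBulk) (S : HomotopySphere 4) :
    ∃ (g : PseudoRiemannianMetric (𝓡 4) ∞ (EuclideanSpace ℝ (Fin 4)) (TangentSpace (𝓡 4) : S.carrier → Type _))
      (_ : g.IsRiemannian) (W : Type) (_ : TopologicalSpace W) (_ : T2Space W)
      (_ : SecondCountableTopology W) (_ : ChartedSpace (EuclideanSpace ℝ (Fin 5)) W)
      (_ : IsManifold (𝓡 5) ∞ W) (_ : ConnectedSpace W)
      (G : PseudoRiemannianMetric (𝓡 5) ∞ (EuclideanSpace ℝ (Fin 5)) (TangentSpace (𝓡 5) : W → Type _))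
      (_ : G.IsRiemannian) (c : ℝ) (Φ : S.carrier × ℝ → W),
      0 < c ∧
      (∀ cov, G.IsLeviCivita cov →
        ∀ (x : W) (X Y : TangentSpace (𝓡 5) x), G.sectionalCurvature cov x X Y ≤ 0) ∧
      ContMDiffOn ((𝓡 4).prod 𝓘(ℝ, ℝ)) (𝓡 5) ∞ Φ (univ ×ˢ Ioo (0 : ℝ) 1) ∧
      InjOn Φ (univ ×ˢ Ioo (0 : ℝ) 1) ∧
      (∀ t ∈ Ioo (0 : ℝ) 1, IsCompact (Φ '' (univ ×ˢ Ioo (0 : ℝ) t))ᶜ) ∧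
      (∀ ε : ℝ, 0 < ε → ∃ t ∈ Ioo (0 : ℝ) 1, ∀ (x : S.carrier) (l : ℝ), l ∈ Ioo (0 : ℝ) t →
        ∀ (v : TangentSpace (𝓡 4) x) (s : ℝ),
          |G.val (Φ (x, l)) (mfderiv ((𝓡 4).prod 𝓘(ℝ, ℝ)) (𝓡 5) Φ (x, l) (v, s))
              (mfderiv ((𝓡 4).prod 𝓘(ℝ, ℝ)) (𝓡 5) Φ (x, l) (v, s)) -
            c * (s ^ 2 + g.val x v v) / l ^ 2| ≤ ε * (c * (s ^ 2 + g.val x v v) / l ^ 2)) := by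
  -- the homotopy equivalence and the instances demanded by the Einstein-bulk items
  obtain ⟨he⟩ := S.nonempty_homotopyEquiv
  haveI : PathConnectedSpace (Metric.sphere (0 : EuclideanSpace ℝ (Fin 5)) 1) := by
    rw [← isPathConnected_iff_pathConnectedSpace]
    refine isPathConnected_sphere ?_ 0 zero_le_one
    rw [← Module.finrank_eq_rank, finrank_euclideanSpace_fin]
    norm_num
  haveI : PathConnectedSpace S.carrier := by
    have e : (Metric.sphere (0 : EuclideanSpace ℝ (Fin 5)) 1) ≃ₕ S.carrier := he.symm
    have key : ∀ y : S.carrier, Joined (e.toFun (e.invFun y)) y := fun y =>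
      ⟨e.right_inv.some.evalAt y⟩
    refine ⟨⟨e.toFun (Classical.arbitrary _)⟩, fun y y' => ?_⟩
    have hmid : Joined (e.toFun (e.invFun y)) (e.toFun (e.invFun y')) :=
      ⟨(PathConnectedSpace.somePath (e.invFun y) (e.invFun y')).map e.toFun.continuous⟩
    exact ((key y).symm.trans hmid).trans (key y')
  letI : MeasurableSpace S.carrier := borel S.carrier
  haveI : BorelSpace S.carrier := ⟨rfl⟩
  -- the two thresholds: Li–Qing–Shi pinching at `ε = 1/2`, and the PE-filling threshold
  obtain ⟨δ₂, hδ₂, H2⟩ := hL (1 / 2) (by norm_num)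
  obtain ⟨δ₃, hδ₃, H3⟩ := hP
  -- Yamabe-extremality at `η = min δ₂ δ₃` gives the near-round class `[g₀]`
  obtain ⟨g₀, hYg⟩ := hY S.carrier he (min δ₂ δ₃) (lt_min hδ₂ hδ₃)
  have mono : ∀ {δ C V I : ℝ}, min δ₂ δ₃ ≤ δ → 0 ≤ C → 0 ≤ V →
      (1 - min δ₂ δ₃) * C * V ≤ I → (1 - δ) * C * V ≤ I := by
    intro δ C V I hδ hC hV h
    exact (mul_le_mul_of_nonneg_right
      (mul_le_mul_of_nonneg_right (sub_le_sub_left hδ 1) hC) hV).trans h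
  -- the Poincaré–Einstein filling of `(Σ, [g₀])`
  obtain ⟨N, _, _, _, _, _, g, _, hRic, hpack⟩ := H3 S.carrier he g₀ (by
    intro h' _ hconf
    exact mono (min_le_right _ _) (by positivity) (Real.sqrt_nonneg _) (hYg h' hconf))
  -- pinching `|Rm + 1| ≤ 1/2` on the bulk, hence `Rm ≤ 0` on orthonormal pairs
  have hpinch := H2 S.carrier g₀ N g hRic hpack (by
    intro h' _ hconf
    exact mono (min_le_left _ _) (by positivity) (Real.sqrt_nonneg _) (hYg h' hconf))
  have hK : ∀ (x : N) (X Y : TangentSpace (𝓡 5) x), g.inner x X X = 1 → g.inner x Y Y = 1 →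
      g.inner x X Y = 0 →
      (PseudoRiemannianMetric.ofRiemannian g).curvatureForm
        (PseudoRiemannianMetric.ofRiemannian g).leviCivita x X Y Y X ≤ 0 := by
    intro x X Y hX1 hY1 hXY0
    have h := abs_le.mp (hpinch x X Y hX1 hY1 hXY0)
    linarith [h.2]
  -- the curvature clause of the crux, for every Levi-Civita connection
  have hsec := sectionalCurvature_nonpos_of_orthonormal_leviCivita N g hK
  -- the compactification collar, C⁰-conical over `κ₀ g₀`
  obtain ⟨hconn, c, κ₀, Φ, hc, hκ₀, hsm, hinj, hco, hasym⟩ :=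
    stub_compactificationCollar S.carrier g₀ N g hpack
  haveI : ConnectedSpace N := hconn
  obtain ⟨gκ, hgκ, hgκv⟩ := exists_scaledMetric hκ₀ (PseudoRiemannianMetric.ofRiemannian g₀)
    (PseudoRiemannianMetric.isRiemannian_ofRiemannian g₀)
  refine ⟨gκ, hgκ, N, inferInstance, inferInstance, inferInstance, inferInstance, inferInstance, hconn,
    PseudoRiemannianMetric.ofRiemannian g, PseudoRiemannianMetric.isRiemannian_ofRiemannian g,
    c, Φ, hc, hsec, hsm, hinj, hco, ?_⟩
  simpa only [hgκv, PseudoRiemannianMetric.val_ofRiemannian] using hasym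

/-- **The crux BY NAME from the three Einstein-bulk items** (tagged route obligations
stmt-SmoothPoincare4-7998 / -7997 / -7996); the line's owned statement is discharged by the landed
`stub_compactificationCollar`. Lands on `ahHadamardFilling_of_connectedCollarFillings` (p124840). -/
theorem AhHadamardFilling_of
    (hY : Summit.SmoothPoincare4.SmoothPoincare4.Theses.EinsteinBulk.YamabeExtremalSpheres)
    (hP : Summit.SmoothPoincare4.SmoothPoincare4.Theses.EinsteinBulk.PEFillNearRound)
    (hL : Summit.SmoothPoincare4.SmoothPoincare4.Theses.EinsteinBulk.YamabePinchedEinsteinBulk) :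
    Summit.SmoothPoincare4.SmoothPoincare4.Theses.InformationMetricHadamard.AhHadamardFilling :=
  UniversalCoverStripsTopology.ahHadamardFilling_of_connectedCollarFillings
    (connectedCollarFillings_of hY hP hL)

end Summit.SmoothPoincare4.SmoothPoincare4.Cruxes.AhHadamardFilling.EinsteinBulkTransfer

end
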